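import Summits.BirchSwinnertonDyer.BirchSwinnertonDyer.Theorems.TeichmullerTwistDescentWeightExclusionTypeII
import Literature.NumberTheory.GaloisRepresentations.SerreWeightLevelOneSwapProofs
import HarnessLib

/-!
# Route `TeichmullerTwistDescent`, crux K `TwistedPeriodLatticeSaturation` (stmt-BirchSwinnertonDyer-25368):
# the weight exclusion (W‴) on KODAIRA TYPE IV (`ord_pΔ_min = 4`, `e = 3`) — and hence on `ord_pΔ_min ≠ 3` — from published facts

Cell `pub/bsd-wall` (D-0145 line route-BirchSwinnertonDyer-TeichmullerTwistDescent, OPEN rev 7), seat `bsd-line-ttd-p1` (prover 1/2,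
g27).  THEOREMS ONLY; `--supports stmt-BirchSwinnertonDyer-25368`.  BSD is not proved by this file; K is NOT proved by this file;
nothing here closes an item.  Companion of `TeichmullerTwistDescentWeightExclusionTypeII` (same hypotheses, same method).

WHAT.  `noEtaleWeightEigenQuotient_typeIV_of_facts`: (W‴) `NoEtaleWeightEigenQuotient` restricted to `padicValInt p Δ_min = 4`
(`3b = p − 1`), from (WEIGHT) `fullLevelHomology_twist_isModular_of_eigenMap`, (SHAPE) `Kraus1997.propOne_inertiaShape_of_ordinary`,
(MIN) `edixhoven1992_serreWeight_le_weight_of_newform`, (UNIQ) `IsSerreWeight.unique` and `isSerreWeight_serreWeightLocal`; and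
`noEtaleWeightEigenQuotient_of_ne_three_of_facts`: (W‴) on `ord_pΔ_min ≠ 3` (types II and IV together).

HOW.  As on type II, with one new point.  Write `b = 2h` (`b` is even since `3b = p − 1`), `T = s + 4h`; (WEIGHT) gives
`6h ∣ 2T`, so `r = T mod 6h ∈ {0, 3h}`.  The twist `ω^s ρ̄_W` has level-one shape `(T + 1, T − 2h) ≡ (1 + r, 4h + r)`:
for `r = 0` this is `(1, 2b)` with `β ≤ α` (`serreWeight_eq_of_hasLevelOneInertiaShape_of_unique`: `k = p + 1 + 2b`); for `r = 3h`
it is `(3h + 1, h)` with `β > α + 1` — the tame sub-case needs the SWAP of the exponents (`HasLevelOneInertiaShape.symm_of_isTamelyRamified`,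
file `SerreWeightLevelOneSwapProofs`), after which `k = 1 + p·h + 3h + 1` (`serreWeight_eq_of_hasLevelOneInertiaShape_of_lt_of_unique`).
Either way `k ≥ p + 1 > 2b + 2 ≥ k` (Edixhoven).  The generic step is `false_of_twist_isModular_of_shape`.
Type III (`e = 4`) is NOT covered: there the branch `r = 2b` has shape `(2b + 1, 0)` and weight exactly `2b + 2` (no contradiction;
the sign `s ≡ b` of the Hecke normalisation would be needed).
-/

set_option autoImplicit false
-- single-conjunct summit: `Summit.BirchSwinnertonDyer.BirchSwinnertonDyer.…` repeats the name by design
set_option linter.dupNamespace false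

noncomputable section

open scoped MatrixGroups NumberField Valued
open Function CongruenceSubgroup IsDedekindDomain ValuativeRel
open Literature.RepresentationTheory.FiniteGroups Literature.RepresentationTheory.FiniteGroups.GL2
  Literature.NumberTheory.EllipticCurves.ModularForms
open Literature.NumberTheory.EllipticCurves (Kato2004.teichmullerChar)
open Literature.NumberTheory.ModularSymbols Literature.NumberTheory.ModularSymbols.FullLevel
open Literature.NumberTheory.GaloisRepresentations Literature.NumberTheory.GaloisRepresentations.ModPGaloisRep
open Literature.NumberTheory.GaloisRepresentations.IsNonarchimedeanLocalField
open Literature.NumberTheory.Automorphic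

namespace Summit.BirchSwinnertonDyer.BirchSwinnertonDyer.Theorems.TeichmullerTwistDescent

open WeierstrassCurve Literature.NumberTheory.EllipticCurves Literature.NumberTheory.EllipticCurves.Rank1Residual
open Summit.BirchSwinnertonDyer.BirchSwinnertonDyer.Theses.TeichmullerTwistDescent

namespace WeightExclusion

/-! ### The contradiction from a normalised shape of the twist -/

/-- **Generic step.**  Coefficients `k = 𝔽̄_p`-like (algebraically closed, characteristic `p`, discrete), `p` odd; `ρ̄` a framed
mod-`p` representation of `Γ_ℚ` with `det ρ̄ = χ̄_p`, absolutely irreducible, whose base change has level-one shape `(a, a')` at every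
local restriction datum at `p`; `f` a newform on `Γ₁(N)`, `p ∤ N`, of weight `w` with `2 ≤ w ≤ p` and `ρ̄_f ≅ ω^s ρ̄ ⊗ k` away from `Np`.
If the shape `(a + s, a' + s)` of the twist is congruent mod `p − 1` to a NORMALISED shape `(β, α)` — either `1 ≤ β ≤ α ≤ p − 2`
or `1 ≤ α`, `α + 2 ≤ β ≤ p − 2` — then `False`: Serre's recipe (granted uniqueness) gives `k(ω^s ρ̄) = 1 + p·min + max ≥ p + 1`,
Edixhoven's minimality gives `k(ω^s ρ̄) ≤ w ≤ p`. [cite: Edixhoven1992, Thm. 4.5] [cite: Serre1987, §2.2–2.4] -/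
theorem false_of_twist_isModular_of_shape {p : ℕ} [Fact p.Prime] {k : Type} [Field k] [TopologicalSpace k] [DiscreteTopology k]
    [CharP k p] [IsAlgClosed k] (hp2 : p ≠ 2)
    (hEd : edixhoven1992_serreWeight_le_weight_of_newform)
    (hUq : ∀ {F : Type} [Field F] [ValuativeRel F] [TopologicalSpace F] [IsNonarchimedeanLocalField F]
      (τ : ModPGaloisRep F k 2) (ι : absIntegers 𝒪[F] F ⧸ absMaximalIdeal F →+* k), IsSerreWeight.unique τ ι)
    (hS : ∀ {F : Type} [Field F] [ValuativeRel F] [TopologicalSpace F] [IsNonarchimedeanLocalField F]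
      (τ : ModPGaloisRep F k 2) (ι : absIntegers 𝒪[F] F ⧸ absMaximalIdeal F →+* k), τ.isSerreWeight_serreWeightLocal ι)
    {ρ : ModPGaloisRep ℚ (ZMod p) 2}
    (hdet : ∀ σ : Field.absoluteGaloisGroup ℚ, Matrix.GeneralLinearGroup.det (ρ σ) = modPCyclotomicCharacterZMod ℚ p σ)
    (habs : FramedRep.IsAbsolutelyIrreducible ρ) (j : ZMod p →+* k) {a a' : ℕ}
    (hKr : ∀ (loc : LocalRestrictionAt p (FramedRep.baseChange j continuous_of_discreteTopology ρ))
      (ι : absIntegers 𝒪[loc.F] loc.F ⧸ absMaximalIdeal loc.F →+* k),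
      loc.rep.HasLevelOneInertiaShape ι ((p : ℕ) : 𝒪[loc.F]) loc.irreducible_natCast a a')
    {s β α : ℕ} (hβ : a + s ≡ β [MOD p - 1]) (hα : a' + s ≡ α [MOD p - 1])
    (hnorm : (1 ≤ β ∧ β ≤ α ∧ α + 2 ≤ p) ∨ (1 ≤ α ∧ α + 2 ≤ β ∧ β + 2 ≤ p))
    {N : ℕ} [NeZero N] (hpN : ¬ p ∣ N) {w : ℤ} (hw2 : 2 ≤ w) (hwp : w ≤ p)
    (f : CuspForm (Gamma1 N) w) (ιf : coeffCharIntegers f →+* k) (hf : IsNewform1 f)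
    (hgal : IsGaloisRepOfNewform1Int f ιf {q | q ∣ N * p}
      (FramedRep.twist (FramedRep.baseChange j continuous_of_discreteTopology ρ) (modPCyclotomicCharacter ℚ k p j ^ s))) :
    False := by
  have hp : p.Prime := Fact.out
  -- irreducibility and oddness of the twist
  have hirrbc : (FramedRep.baseChange j continuous_of_discreteTopology ρ).toContinuousRep.IsIrreducible :=
    habs.isIrreducible_baseChange k j _
  have hirr' : (FramedGaloisRep.toGaloisRep (K := ℚ)
      (FramedRep.twist (FramedRep.baseChange j continuous_of_discreteTopology ρ) (modPCyclotomicCharacter ℚ k p j ^ s) :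
        ModPGaloisRep ℚ k 2)).IsIrreducible := by
    refine FramedRep.isIrreducible_of_twist (χ := modPCyclotomicCharacter ℚ k p j ^ s) (fun g => ?_) hirrbc
    rw [FramedRep.twist_apply]
    congr 1
  have hodd : FramedGaloisRep.IsOdd (FramedRep.baseChange j continuous_of_discreteTopology ρ) :=
    (ModPGaloisRep.isOdd_of_det_eq_modPCyclotomicCharacterZMod ρ hdet).baseChange j _
  have hodd' : FramedGaloisRep.IsOdd
      (FramedRep.twist (FramedRep.baseChange j continuous_of_discreteTopology ρ) (modPCyclotomicCharacter ℚ k p j ^ s)) := by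
    intro φ c hc
    rw [FramedRep.det_twist_apply, ← map_pow, hc.sq_eq_one, map_one, one_mul]
    exact hodd φ c hc
  -- local restriction datum, residue embedding, twisted datum
  obtain ⟨loc₀⟩ := nonempty_localRestrictionAt p (FramedRep.baseChange j continuous_of_discreteTopology ρ)
  obtain ⟨ι⟩ := nonempty_ringHom_residue (k := k) p loc₀.F loc₀.residueFieldCard_eq
  have hι : Function.Injective ι := by
    letI : Field (absIntegers 𝒪[loc₀.F] loc₀.F ⧸ absMaximalIdeal loc₀.F) := Ideal.Quotient.field _
    exact ι.injective
  let loc' : LocalRestrictionAt p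
      (FramedRep.twist (FramedRep.baseChange j continuous_of_discreteTopology ρ) (modPCyclotomicCharacter ℚ k p j ^ s) :
        ModPGaloisRep ℚ k 2) :=
    { F := loc₀.F
      residueFieldCard_eq := loc₀.residueFieldCard_eq
      irreducible_natCast := loc₀.irreducible_natCast
      rep := FramedRep.twist loc₀.rep ((modPCyclotomicCharacter ℚ k p j ^ s).comp (absGaloisRestrict ℚ loc₀.F))
      rep_eq_restrictField := by rw [loc₀.rep_eq_restrictField, restrictField_twist] }
  -- Edixhoven: `k(ω^s ρ̄) ≤ w`
  have hdet' : ∃ σ ∈ absInertia loc'.F, Matrix.GeneralLinearGroup.det (loc'.rep σ) ≠ 1 :=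
    exists_det_twist_ne_one hp2 hdet j loc₀ s
  have hle := hEd p (hp.odd_of_ne_two hp2) k _ hirr' hodd' N hpN w hw2 f ιf hf hgal loc' ι hdet'
  -- the shape of the twist, normalised
  have hsh := hasLevelOneInertiaShape_twist_pow loc₀ ι j (hKr loc₀ ι) s
  have hq : residueFieldCard loc₀.F - 1 = p - 1 := by rw [loc₀.residueFieldCard_eq]
  have hsh' : loc'.rep.HasLevelOneInertiaShape ι ((p : ℕ) : 𝒪[loc'.F]) loc'.irreducible_natCast β α :=
    hsh.of_modEq (by rw [hq]; exact hβ) (by rw [hq]; exact hα)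
  -- Serre's recipe evaluated by uniqueness: `k(ω^s ρ̄) ≥ p + 1`
  have hge : p + 1 ≤ serreWeight p _ loc' ι := by
    rcases hnorm with ⟨h1, h2, h3⟩ | ⟨h1, h2, h3⟩
    · rw [serreWeight_eq_of_hasLevelOneInertiaShape_of_unique loc' ι (hUq loc'.rep ι) hι (hS loc'.rep ι) hsh' h1 h2 h3]
      have : p ≤ p * β := Nat.le_mul_of_pos_right p (by omega)
      omega
    · rw [serreWeight_eq_of_hasLevelOneInertiaShape_of_lt_of_unique loc' ι (hUq loc'.rep ι) hι (hS loc'.rep ι) hsh' h1 h2 h3]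
      have : p ≤ p * α := Nat.le_mul_of_pos_right p (by omega)
      omega
  omega

/-! ### Type IV arithmetic: the two normalised shapes -/

/-- Type IV, even branch: with `6h = p − 1`, `b = 2h`, `s + 4h = 3h·c`, `c` even, the exponents `(p − b + s, b + s)` of the twist are
`≡ (1, 2b)` mod `p − 1`. [folklore] -/
theorem typeIV_shape_even {p b h s c : ℕ} (h6h : 6 * h = p - 1) (hbh : b = 2 * h) (hh : 1 ≤ h) (hx : s + 4 * h = 3 * h * c)
    (hc : c % 2 = 0) : p - b + s ≡ 1 [MOD p - 1] ∧ b + s ≡ 2 * b [MOD p - 1] := by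
  obtain ⟨hmod, -⟩ := mod_six_mul_of_eq_three_mul h c (s + 4 * h) hx
  rw [hc, mul_zero] at hmod
  have hsr : s + 4 * h ≡ 0 [MOD p - 1] := by unfold Nat.ModEq; rw [← h6h, hmod, Nat.zero_mod]
  refine ⟨?_, ?_⟩
  · rw [show p - b + s = s + 4 * h + 1 by omega]
    exact hsr.add_right 1
  · refine Nat.ModEq.add_right_cancel' (2 * h) ?_
    rw [show b + s + 2 * h = s + 4 * h by omega, show 2 * b + 2 * h = 0 + (p - 1) by omega]
    exact hsr.trans Nat.add_modEq_right.symm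

/-- Type IV, odd branch: with `6h = p − 1`, `b = 2h`, `s + 4h = 3h·c`, `c` odd, the exponents `(p − b + s, b + s)` of the twist are
`≡ (3h + 1, h)` mod `p − 1`. [folklore] -/
theorem typeIV_shape_odd {p b h s c : ℕ} (h6h : 6 * h = p - 1) (hbh : b = 2 * h) (hh : 1 ≤ h) (hx : s + 4 * h = 3 * h * c)
    (hc : c % 2 = 1) : p - b + s ≡ 3 * h + 1 [MOD p - 1] ∧ b + s ≡ h [MOD p - 1] := by
  obtain ⟨hmod, -⟩ := mod_six_mul_of_eq_three_mul h c (s + 4 * h) hx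
  rw [hc, mul_one] at hmod
  have hsr : s + 4 * h ≡ 3 * h [MOD p - 1] := by unfold Nat.ModEq; rw [← h6h, hmod, Nat.mod_eq_of_lt (by omega)]
  refine ⟨?_, ?_⟩
  · rw [show p - b + s = s + 4 * h + 1 by omega]
    exact hsr.add_right 1
  · refine Nat.ModEq.add_right_cancel' (2 * h) ?_
    rw [show b + s + 2 * h = s + 4 * h by omega, show h + 2 * h = 3 * h by ring]
    exact hsr

/-! ### (W‴) on Kodaira type IV -/

/-- **(W‴) `NoEtaleWeightEigenQuotient` restricted to Kodaira type IV (`ord_pΔ_min = 4`, `3b = p − 1`), from published facts** —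
hypotheses and conclusion exactly as in `noEtaleWeightEigenQuotient_typeII_of_facts` with `= 2` replaced by `= 4`.  Proof: with
`b = 2h` and `T = s + 4h`, (WEIGHT) gives `3h ∣ T`; if `T/3h` is even the twist has normalised shape `(1, 2b)`, if odd `(3h + 1, h)`
(`β > α + 1`, swap in the tame case); `false_of_twist_isModular_of_shape` concludes.
[cite: BuzzardDiamondJarvis2010, §2 Prop. 2.5, Cor. 2.10] [cite: Kraus1997Dissertationes, Prop. 1] [cite: Edixhoven1992, Thm. 4.5]
[cite: Serre1987, §2.2–2.4] -/
theorem noEtaleWeightEigenQuotient_typeIV_of_facts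
    (hWt : fullLevelHomology_twist_isModular_of_eigenMap)
    (hKr : Kraus1997.propOne_inertiaShape_of_ordinary)
    (hEd : edixhoven1992_serreWeight_le_weight_of_newform)
    (hUq : ∀ {k : Type} [Field k] [TopologicalSpace k] {F : Type} [Field F] [ValuativeRel F] [TopologicalSpace F]
      [IsNonarchimedeanLocalField F] (τ : ModPGaloisRep F k 2) (ι : absIntegers 𝒪[F] F ⧸ absMaximalIdeal F →+* k),
      IsSerreWeight.unique τ ι)
    (hS : ∀ {k : Type} [Field k] [TopologicalSpace k] {F : Type} [Field F] [ValuativeRel F] [TopologicalSpace F]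
      [IsNonarchimedeanLocalField F] (τ : ModPGaloisRep F k 2) (ι : absIntegers 𝒪[F] F ⧸ absMaximalIdeal F →+* k),
      τ.isSerreWeight_serreWeightLocal ι)
    (p M : ℕ) [Fact p.Prime] [NeZero M] (W : WeierstrassCurve ℚ) [W.IsElliptic] [W.IsGloballyMinimal]
    (hN : W.conductorNorm ℤ = p ^ 2 * M) (hp11 : 11 ≤ p) (hadd : Rank1Residual.Addv W p) (hirr : Rank1Residual.Irr W p)
    (hGo : Summit.BirchSwinnertonDyer.Rank1Residual.Additive.TypeGOrd W p) (hV4 : padicValInt p W.minimalDiscriminantInt ≤ 4)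
    (hIV : padicValInt p W.minimalDiscriminantInt = 4) :
    letI : Algebra ℤ_[p] (ZMod p) := (PadicInt.toZMod (p := p)).toAlgebra
    ∀ Θ : H1carrier ℤ_[p] p M →ₗ[ℤ_[p]] ↥(MvPolynomial.homogeneousSubmodule (Fin 2) (ZMod p) (2 * tameExponent p W)),
    (∀ (g : GL (Fin 2) (ZMod p)) (z : H1carrier ℤ_[p] p M),
        Θ (H1carrierRep ℤ_[p] p M g z) =
          symPowTwist (ZMod.castHom (dvd_refl p) (ZMod p))
            (reduceChar (ZMod p) (Kato2004.teichmullerChar p ^ (p - 1 - tameExponent p W)))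
            (2 * tameExponent p W) g (Θ z)) →
    (∀ (q : ℕ) [NeZero q] (hq : q.Prime) (hqp : q ≠ p) (z : H1carrier ℤ_[p] p M),
        Θ (heckeT ℤ_[p] p M hq hqp z) = (((W.LFunction q : ℤ) : ZMod p)) • Θ z) →
    Θ = 0 := by
  intro Θ hΘG hΘT
  by_contra hΘ0
  have hp : p.Prime := Fact.out
  have hp5 : 5 ≤ p := le_trans (by norm_num) hp11
  have hp2 : p ≠ 2 := by omega
  -- type IV arithmetic: `3 b = p - 1`, `b = 2 h`, `2 ≤ h`
  have h3b : 3 * tameExponent p W = p - 1 := by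
    rcases TameExponent.tameExponent_cases W p hp5 hadd hGo hV4 with ⟨h2, _, _⟩ | ⟨h3, _, _⟩ | ⟨_, _, h⟩
    · omega
    · omega
    · exact h
  have h13 := TameExponent.thirteen_le W p hp11 hadd hGo hV4
  obtain ⟨m, hm⟩ := hp.eq_two_or_odd'.resolve_left hp2
  obtain ⟨h, hbh⟩ : ∃ h : ℕ, tameExponent p W = 2 * h := ⟨tameExponent p W / 2, by omega⟩
  have h6h : 6 * h = p - 1 := by omega
  have hh2 : 2 ≤ h := by omega
  -- `p ∤ M`
  have hpM : Nat.Coprime p M := coprime_of_conductorNorm_eq_sq_mul W p M hp5 hN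
  -- a framed model of `W[p]`, coefficients `𝔽̄_p`
  haveI : NeZero ((p : ℕ) : ℚ) := ⟨by exact_mod_cast hp.ne_zero⟩
  obtain ⟨ρ, hρ⟩ := W.exists_isTorsionGaloisRep p
  letI : TopologicalSpace (AlgebraicClosure (ZMod p)) := ⊥
  haveI : DiscreteTopology (AlgebraicClosure (ZMod p)) := ⟨rfl⟩
  -- (WEIGHT)
  obtain ⟨s, N, hN0, f, ιf, hsdiv, hpN, hf, hgal⟩ :=
    hWt p M W (2 * tameExponent p W) (p - 1 - tameExponent p W) hp5 hpM (by omega) ⟨2, by omega⟩ hirr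
      ⟨Θ, hΘ0, hΘG, hΘT⟩ ρ hρ (AlgebraicClosure (ZMod p)) (algebraMap (ZMod p) (AlgebraicClosure (ZMod p)))
  haveI := hN0
  have hPGO : W.HasPotentiallyGoodOrdinaryReductionAtPrime p :=
    W.hasPotentiallyGoodOrdinaryReductionAtPrime_of_forall_intermediateField p hp hGo
  have hKr' : ∀ (loc : LocalRestrictionAt p (FramedRep.baseChange (algebraMap (ZMod p) (AlgebraicClosure (ZMod p)))
      continuous_of_discreteTopology ρ)) (ι : absIntegers 𝒪[loc.F] loc.F ⧸ absMaximalIdeal loc.F →+* AlgebraicClosure (ZMod p)),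
      loc.rep.HasLevelOneInertiaShape ι ((p : ℕ) : 𝒪[loc.F]) loc.irreducible_natCast (p - tameExponent p W) (tameExponent p W) :=
    fun loc ι => hKr p hp5 W hadd hPGO ρ hρ (AlgebraicClosure (ZMod p)) _ continuous_of_discreteTopology loc ι
  -- `s + 4h = 3h·c`
  obtain ⟨c, hc⟩ := hsdiv
  have hx : s + 4 * h = 3 * h * c := by
    rw [show p - 1 - tameExponent p W = 4 * h by omega, ← h6h] at hc
    exact Nat.eq_of_mul_eq_mul_left two_pos (by rw [hc]; ring)
  have hw2 : (2 : ℤ) ≤ ((2 * tameExponent p W : ℕ) : ℤ) + 2 := by omega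
  have hwp : ((2 * tameExponent p W : ℕ) : ℤ) + 2 ≤ p := by push_cast; omega
  rcases Nat.mod_two_eq_zero_or_one c with hc0 | hc1
  · obtain ⟨hβ, hα⟩ := typeIV_shape_even h6h hbh (by omega) hx hc0
    exact false_of_twist_isModular_of_shape hp2 hEd hUq hS (W.det_eq_modPCyclotomicCharacter_of_isTorsionGaloisRep_holds p ρ hρ)
      (BCDT.isAbsolutelyIrreducible_of_hasIrreducibleModPGaloisRep W hp2 hirr hρ) _ hKr' hβ hα
      (Or.inl ⟨le_rfl, by omega, by omega⟩) hpN hw2 hwp f ιf hf hgal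
  · obtain ⟨hβ, hα⟩ := typeIV_shape_odd h6h hbh (by omega) hx hc1
    exact false_of_twist_isModular_of_shape hp2 hEd hUq hS (W.det_eq_modPCyclotomicCharacter_of_isTorsionGaloisRep_holds p ρ hρ)
      (BCDT.isAbsolutelyIrreducible_of_hasIrreducibleModPGaloisRep W hp2 hirr hρ) _ hKr' hβ hα
      (Or.inr ⟨by omega, by omega, by omega⟩) hpN hw2 hwp f ιf hf hgal

/-! ### (W‴) off Kodaira type III -/

/-- **(W‴) `NoEtaleWeightEigenQuotient` on `ord_pΔ_min ≠ 3` (Kodaira types II and IV), from published facts** — the conjunction of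
`noEtaleWeightEigenQuotient_typeII_of_facts` and `noEtaleWeightEigenQuotient_typeIV_of_facts` (`ord_pΔ_min ∈ {2, 3, 4}` under the
prefix, `TameExponent.padicValInt_mem`).  What remains of (W‴) after this file is exactly Kodaira type III (`ord_pΔ_min = 3`, `e = 4`),
where the method needs the sign `s ≡ b (mod p − 1)` of the twist exponent.
[cite: BuzzardDiamondJarvis2010, §2 Prop. 2.5, Cor. 2.10] [cite: Kraus1997Dissertationes, Prop. 1] [cite: Edixhoven1992, Thm. 4.5]
[cite: Serre1987, §2.2–2.4] -/
theorem noEtaleWeightEigenQuotient_of_ne_three_of_facts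
    (hWt : fullLevelHomology_twist_isModular_of_eigenMap)
    (hKr : Kraus1997.propOne_inertiaShape_of_ordinary)
    (hEd : edixhoven1992_serreWeight_le_weight_of_newform)
    (hUq : ∀ {k : Type} [Field k] [TopologicalSpace k] {F : Type} [Field F] [ValuativeRel F] [TopologicalSpace F]
      [IsNonarchimedeanLocalField F] (τ : ModPGaloisRep F k 2) (ι : absIntegers 𝒪[F] F ⧸ absMaximalIdeal F →+* k),
      IsSerreWeight.unique τ ι)
    (hS : ∀ {k : Type} [Field k] [TopologicalSpace k] {F : Type} [Field F] [ValuativeRel F] [TopologicalSpace F]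
      [IsNonarchimedeanLocalField F] (τ : ModPGaloisRep F k 2) (ι : absIntegers 𝒪[F] F ⧸ absMaximalIdeal F →+* k),
      τ.isSerreWeight_serreWeightLocal ι)
    (p M : ℕ) [Fact p.Prime] [NeZero M] (W : WeierstrassCurve ℚ) [W.IsElliptic] [W.IsGloballyMinimal]
    (hN : W.conductorNorm ℤ = p ^ 2 * M) (hp11 : 11 ≤ p) (hadd : Rank1Residual.Addv W p) (hirr : Rank1Residual.Irr W p)
    (hGo : Summit.BirchSwinnertonDyer.Rank1Residual.Additive.TypeGOrd W p) (hV4 : padicValInt p W.minimalDiscriminantInt ≤ 4)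
    (hIII : padicValInt p W.minimalDiscriminantInt ≠ 3) :
    letI : Algebra ℤ_[p] (ZMod p) := (PadicInt.toZMod (p := p)).toAlgebra
    ∀ Θ : H1carrier ℤ_[p] p M →ₗ[ℤ_[p]] ↥(MvPolynomial.homogeneousSubmodule (Fin 2) (ZMod p) (2 * tameExponent p W)),
    (∀ (g : GL (Fin 2) (ZMod p)) (z : H1carrier ℤ_[p] p M),
        Θ (H1carrierRep ℤ_[p] p M g z) =
          symPowTwist (ZMod.castHom (dvd_refl p) (ZMod p))
            (reduceChar (ZMod p) (Kato2004.teichmullerChar p ^ (p - 1 - tameExponent p W)))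
            (2 * tameExponent p W) g (Θ z)) →
    (∀ (q : ℕ) [NeZero q] (hq : q.Prime) (hqp : q ≠ p) (z : H1carrier ℤ_[p] p M),
        Θ (heckeT ℤ_[p] p M hq hqp z) = (((W.LFunction q : ℤ) : ZMod p)) • Θ z) →
    Θ = 0 := by
  intro Θ hΘG hΘT
  have hp5 : 5 ≤ p := le_trans (by norm_num) hp11
  rcases TameExponent.padicValInt_mem W p hp5 hadd hV4 with h2 | h3 | h4
  · exact noEtaleWeightEigenQuotient_typeII_of_facts hWt hKr hEd hUq hS p M W hN hp11 hadd hirr hGo hV4 h2 Θ hΘG hΘT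
  · exact absurd h3 hIII
  · exact noEtaleWeightEigenQuotient_typeIV_of_facts hWt hKr hEd hUq hS p M W hN hp11 hadd hirr hGo hV4 h4 Θ hΘG hΘT

end WeightExclusion

end Summit.BirchSwinnertonDyer.BirchSwinnertonDyer.Theorems.TeichmullerTwistDescent
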